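import Summits.QuantumFields.YangMills.Theorems.LuscherReductionTwistedTraceScalingBOSupportGeometry
import HarnessLib

/-!
# R36 — the crude fibre-support lemma cannot discharge `BOBricks.hbo` at the record fat radius `3δ`
# (support-geometry guard for lane A's (G) assembly; crux `TwistedTraceScaling`, stmt-QuantumFields-20203)

Lane A's typed brick list `BOBricks L χ δ` (`…BOAssemblyBricks`, p648135) carries two structural fields about the slow window `𝒰 ⊆ {orbitDist₁ < δ₁}`:
* `hshadow` — every configuration `U` with `χ U ≠ 0` and `orbitDist U < δ` has its slow mean in `𝒰`;
* `hbo` — every Born–Oppenheimer function with amplitude supported in `𝒰` is supported in `supp χ` (∩ a lax orbit ball).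
For the record weight `χ = recordWeightRho (3δ) ρ δg` (fat orbit radius `δ' = 3δ`, the weight of the target `innerNoIntruderOneOrbitAt_pow_of_bricks`) the
support lemma offered for `hbo` is `boFun_support_record` (`…BOSupportGeometry`, p649470), whose hypothesis is `|Edge 3 L|·(4r + δ₁) < δ'` — it rests on the
crude bound `orbitDist_orthoTube_le : orbitDist (orthoTube u v) ≤ |Edge 3 L|·(4r + δ₁)`, which charges EVERY edge the whole one-site orbit distance `δ₁`
instead of its own direction's share `δ₁/3`.

**Finding (kernel-checked below).**  `hshadow` alone forces `|Edge 3 L|·δ₁ ≥ 3δ = δ'`: the constant diagonal configurations `U_θ = constLift (diag(e^{iθ},e^{−iθ}))`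
lie in the fat tube, have `orbitDist U_θ ≤ |Edge 3 L|·‖diag_θ − 1‖_F` (gauge `g = 1`) and slow mean `diag_θ` with one-site orbit distance EXACTLY `3‖diag_θ − 1‖_F`
(`orbitDist_one_site_eq`); letting `|Edge 3 L|·‖diag_θ − 1‖_F ↑ δ` (intermediate value theorem on `θ ↦ 2√(1 − cos θ)`) gives `δ₁ ≥ 3δ/|Edge 3 L|`.  Hence the
hypothesis `|Edge 3 L|·(4r + δ₁) < 3δ` of `boFun_support_record` is UNSATISFIABLE for every fibre radius `r ≥ 0` jointly with `hshadow ∧ h𝒰δ₁`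
(`not_support_record_hyp`, and the eventually-form `not_eventually_support_record_hyp` matching the `BOBricks` fields): the planned discharge
«`δ₁ := c_L·δ`, `hbo` by `boFun_support_record`» (COARSE-DESIGN §24.7) needs `c_L < 1/L³` and `c_L ≥ 1/L³` at once.

**Repair (positive helper, also below).**  The sharp slow part is `|Edge 3 L|/3 · orbitDist₁ u` (each direction has `|Site 3 L|` edges):
`orbitDist_orthoTube_le_sharp : orbitDist (orthoTube u v) ≤ (|Edge 3 L|/3)·orbitDist u + 4·Σ_e ‖v_e‖`, under which `hbo` at radius `3δ` needs only
`(|Edge 3 L|/3)·δ₁ + 4|Edge 3 L|·r < 3δ`, compatible with `δ₁ ≥ 3δ/|Edge 3 L|` as soon as `2|Edge 3 L|·r < δ` (`sharp_window_nonempty`) — true eventually for the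
Gaussian fibre radius `r ≍ β^{−1/2}·polylog ≪ δ = β^{−s}`.  (Alternatively: fat radius `> 3δ(1 + 4|Edge|r/δ)` with the crude bound; R34 shows the fat parameters are decorative.)

HONEST FRAMING: this refutes NO registered statement and NOT `BOBricks` (whose fields remain jointly satisfiable in principle); it shows that ONE offered
discharge route for one structural field is vacuous at the record parameters and names the repair.  Stub of a child of the CONDITIONAL reduction route R2b1;
C4 OPEN; not a gap, not Clay.
-/

set_option autoImplicit false

noncomputable section

open MeasureTheory Filter Topology Real
open scoped BigOperators
open Literature.MathematicalPhysics.QuantumFieldTheory hiding SU2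
open Literature.MathematicalPhysics.QuantumLattice

namespace Summit.QuantumFields.YangMills.Theorems.TwistedTraceScaling.Negative.R36

open Summit.QuantumFields.YangMills.Theorems.FemtoTransferGap
open Summit.QuantumFields.YangMills.Theorems.FemtoTransferGap.TwoLattice.Avg
open Summit.QuantumFields.YangMills.Theorems.FemtoTransferGap.TwoLattice.ConstTube

variable {L : ℕ} [NeZero L]

/-! ## §1 The witness family: constant diagonal configurations -/

/-! The witness is the one-site constant diagonal configuration `u_θ := fun _ => diagSU2 θ` (`diag(e^{iθ}, e^{−iθ})` on all three links) and its constant lift. -/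

/-- `‖diag_θ − 1‖_F = √(4(1 − cos θ))`. [folklore] -/
theorem frobNorm_diagSU2_sub_one_eq_sqrt (θ : ℝ) :
    frobNorm (((diagSU2 θ : SU2) : Matrix (Fin 2) (Fin 2) ℂ) - 1) = Real.sqrt (4 * (1 - Real.cos θ)) := by
  rw [← frobNorm_diagSU2_sub_one_sq, Real.sqrt_sq (frobNorm_nonneg _)]

/-- Every value `c ∈ [0, 2]` is a link distance `‖diag_θ − 1‖_F` (intermediate value theorem on `[0, π]`). [folklore] -/
theorem exists_frobNorm_diagSU2_eq {c : ℝ} (hc0 : 0 ≤ c) (hc2 : c ≤ 2) :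
    ∃ θ : ℝ, frobNorm (((diagSU2 θ : SU2) : Matrix (Fin 2) (Fin 2) ℂ) - 1) = c := by
  have hg : ContinuousOn (fun θ : ℝ => Real.sqrt (4 * (1 - Real.cos θ))) (Set.Icc 0 π) :=
    (Real.continuous_sqrt.comp (by fun_prop : Continuous fun θ : ℝ => 4 * (1 - Real.cos θ))).continuousOn
  have hπ : (2 : ℝ) ≤ Real.sqrt (4 * (1 - Real.cos π)) :=
    calc (2 : ℝ) = Real.sqrt (2 ^ 2) := (Real.sqrt_sq (by norm_num)).symm
      _ ≤ Real.sqrt (4 * (1 - Real.cos π)) := Real.sqrt_le_sqrt (by rw [Real.cos_pi]; norm_num)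
  obtain ⟨θ, -, hθ⟩ := intermediate_value_Icc Real.pi_pos.le hg ⟨by simpa using hc0, hc2.trans hπ⟩
  exact ⟨θ, by rw [frobNorm_diagSU2_sub_one_eq_sqrt]; exact hθ⟩

/-- `|Edge 3 L| = 3·|Site 3 L|`. [folklore] -/
theorem card_edge_eq : (Fintype.card (Edge 3 L) : ℝ) = 3 * Fintype.card (Site 3 L) := by
  have : Fintype.card (Edge 3 L) = Fintype.card (Site 3 L) * 3 := by simp [Edge, Fintype.card_prod]
  rw [this]; push_cast; ring

/-- `|Edge 3 L| ≥ 3`. [folklore] -/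
theorem three_le_card_edge : (3 : ℝ) ≤ Fintype.card (Edge 3 L) := by
  rw [card_edge_eq]
  have : 1 ≤ Fintype.card (Site 3 L) := Fintype.card_pos_iff.mpr ⟨fun _ => 0⟩
  have : (1 : ℝ) ≤ Fintype.card (Site 3 L) := by exact_mod_cast this
  linarith

/-- One site: `orbitDist u_θ = 3‖diag_θ − 1‖_F` EXACTLY. [folklore] -/
theorem orbitDist_constDiag₁ (θ : ℝ) :
    orbitDist (fun _ : Edge 3 1 => diagSU2 θ) = 3 * frobNorm (((diagSU2 θ : SU2) : Matrix (Fin 2) (Fin 2) ℂ) - 1) := by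
  have h3 : Fintype.card (Edge 3 1) = 3 := by simp [Edge, Fintype.card_prod]
  rw [orbitDist_one_site_eq, Finset.sum_const, Finset.card_univ, nsmul_eq_mul, h3]
  norm_num

/-- The slow mean of a constant lift is the one-site configuration itself. [folklore] -/
theorem slowMean_constLift (u : GaugeConfig 3 1 SU2) : slowMean L (constLift L u) = u := by
  have h : orthoTube L u 0 = constLift L u := by
    funext e; simp [orthoTube_apply, chartSU2_zero']
  rw [← h]; exact slowMean_orthoTube L u (zero_mem_capBalancedSet L)

/-- `orbitDist (constLift u) ≤ Σ_{e ∈ Edge 3 L} ‖u_{dir e} − 1‖_F` (gauge `g = 1`). [folklore] -/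
theorem orbitDist_constLift_le_sum (u : GaugeConfig 3 1 SU2) :
    orbitDist (constLift L u) ≤ ∑ e : Edge 3 L, frobNorm (((u (0, e.2) : SU2) : Matrix (Fin 2) (Fin 2) ℂ) - 1) := by
  refine (orbitDist_le 1 _).trans (le_of_eq ?_)
  unfold gaugeDist
  rw [TT.gaugeTransform_one']
  rfl

/-- `orbitDist (constLift u_θ) ≤ |Edge 3 L|·‖diag_θ − 1‖_F`. [folklore] -/
theorem orbitDist_constLift_constDiag₁_le (θ : ℝ) :
    orbitDist (constLift L fun _ : Edge 3 1 => diagSU2 θ) ≤ Fintype.card (Edge 3 L) * frobNorm (((diagSU2 θ : SU2) : Matrix (Fin 2) (Fin 2) ℂ) - 1) := by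
  refine (orbitDist_constLift_le_sum _).trans (le_of_eq ?_)
  rw [Finset.sum_const, Finset.card_univ, nsmul_eq_mul]

/-! ## §2 ★ The shadow field forces `|Edge 3 L|·δ₁ ≥ 3δ` -/

/-- ★ **R36a.**  For the record-shaped weight `recordWeightRho δ' ρ δg` with `δ ≤ δ' β`, `δ ≤ ρ β`, `0 < δ ≤ 1`: if the slow window `𝒰 ⊆ {orbitDist₁ < δ₁}` contains the slow mean of
every weighted configuration with `orbitDist < δ` (`BOBricks.h𝒰δ₁ ∧ hshadow` at one `β`), then `3δ ≤ |Edge 3 L|·δ₁`. [folklore] -/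
theorem three_mul_le_card_mul_delta1 {δ' ρ δg : ℝ → ℝ} {β δ : ℝ} (hδ0 : 0 < δ) (hδ1 : δ ≤ 1) (hδ' : δ ≤ δ' β) (hρ : δ ≤ ρ β)
    {𝒰 : Set (GaugeConfig 3 1 SU2)} {δ₁ : ℝ} (h𝒰δ₁ : ∀ u ∈ 𝒰, orbitDist u < δ₁)
    (hshadow : ∀ U : GaugeConfig 3 L SU2, recordWeightRho L δ' ρ δg β U ≠ 0 → orbitDist U < δ → slowMean L U ∈ 𝒰) :
    3 * δ ≤ Fintype.card (Edge 3 L) * δ₁ := by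
  set N : ℝ := (Fintype.card (Edge 3 L) : ℝ) with hN
  have hN3 : (3 : ℝ) ≤ N := three_le_card_edge
  have hNpos : 0 < N := by linarith
  -- every `c ≥ 0` with `N·c < δ` satisfies `3c < δ₁`
  have key : ∀ c : ℝ, 0 ≤ c → N * c < δ → 3 * c < δ₁ := by
    intro c hc0 hcN
    have hc2 : c ≤ 2 := by nlinarith
    obtain ⟨θ, hθ⟩ := exists_frobNorm_diagSU2_eq hc0 hc2
    set U : GaugeConfig 3 L SU2 := constLift L fun _ : Edge 3 1 => diagSU2 θ with hU
    have hdist : orbitDist U < δ := (orbitDist_constLift_constDiag₁_le θ).trans_lt (by rw [hθ]; exact hcN)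
    have hnear : U ∈ nearOne L (ρ β) := by
      intro e
      rw [hU, constLift_apply, hθ]
      nlinarith
    have hfat : U ∈ fatTubeRho L δ' ρ β := ⟨hnear, hdist.trans_le hδ'⟩
    have hχ : recordWeightRho L δ' ρ δg β U ≠ 0 := by
      unfold recordWeightRho
      rw [Set.indicator_of_mem hfat, one_mul]
      exact (Real.exp_pos _).ne'
    have hmem := hshadow U hχ hdist
    rw [hU, slowMean_constLift] at hmem
    have h := h𝒰δ₁ _ hmem
    rwa [orbitDist_constDiag₁, hθ] at h
  by_contra h
  push Not at h
  have hδ₁pos : 0 < δ₁ := by have := key 0 le_rfl (by simpa using hδ0); linarith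
  have h1 : δ₁ / 3 < δ / N := by rw [div_lt_div_iff₀ (by norm_num) hNpos]; linarith
  set c : ℝ := (δ₁ / 3 + δ / N) / 2 with hc
  have hc0 : 0 ≤ c := by positivity
  have hclt : c < δ / N := by rw [hc]; linarith
  have hcN : N * c < δ := by
    calc N * c < N * (δ / N) := mul_lt_mul_of_pos_left hclt hNpos
      _ = δ := mul_div_cancel₀ _ hNpos.ne'
  have h3 := key c hc0 hcN
  have : δ₁ / 3 < c := by rw [hc]; linarith
  linarith

/-- ★ **R36b.**  Consequently the hypothesis `|Edge 3 L|·(4r + δ₁) < δ' β` of `boFun_support_record` is unsatisfiable at fat radius `δ' β = 3δ` for every `r ≥ 0`,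
jointly with `h𝒰δ₁ ∧ hshadow`. [folklore] -/
theorem not_support_record_hyp {δ' ρ δg : ℝ → ℝ} {β δ : ℝ} (hδ0 : 0 < δ) (hδ1 : δ ≤ 1) (hδ' : δ' β = 3 * δ) (hρ : δ ≤ ρ β)
    {𝒰 : Set (GaugeConfig 3 1 SU2)} {δ₁ : ℝ} (h𝒰δ₁ : ∀ u ∈ 𝒰, orbitDist u < δ₁)
    (hshadow : ∀ U : GaugeConfig 3 L SU2, recordWeightRho L δ' ρ δg β U ≠ 0 → orbitDist U < δ → slowMean L U ∈ 𝒰) {r : ℝ} (hr : 0 ≤ r) :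
    ¬ (Fintype.card (Edge 3 L) * (4 * r + δ₁) < δ' β) := by
  have h := three_mul_le_card_mul_delta1 (L := L) hδ0 hδ1 (by rw [hδ']; linarith) hρ h𝒰δ₁ hshadow
  have hN : (0 : ℝ) ≤ Fintype.card (Edge 3 L) := Nat.cast_nonneg _
  intro hlt
  rw [hδ'] at hlt
  nlinarith

/-- ★ **R36c (eventually-form, the `BOBricks` fields verbatim).**  For `χ β = recordWeightRho L δ' ρ δg β` with `δ' = 3δ`, `δ ≤ ρ`, `0 < δ ≤ 1` eventually, the fields
`h𝒰δ₁ : ∀ β, ∀ u ∈ 𝒰 β, orbitDist u < δ₁ β` and `hshadow : ∀ᶠ β, ∀ U, χ β U ≠ 0 → orbitDist U < δ β → slowMean U ∈ 𝒰 β` exclude `∀ᶠ β, |Edge 3 L|·(4 r β + δ₁ β) < δ' β`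
for EVERY nonnegative fibre-radius schedule `r`. [folklore] -/
theorem not_eventually_support_record_hyp {δ' ρ δg δ δ₁ r : ℝ → ℝ} (hδ' : ∀ β, δ' β = 3 * δ β) (hδ0 : ∀ᶠ β in atTop, 0 < δ β) (hδ1 : ∀ᶠ β in atTop, δ β ≤ 1)
    (hρ : ∀ᶠ β in atTop, δ β ≤ ρ β) (hr : ∀ β, 0 ≤ r β) {𝒰 : ℝ → Set (GaugeConfig 3 1 SU2)} (h𝒰δ₁ : ∀ β, ∀ u ∈ 𝒰 β, orbitDist u < δ₁ β)
    (hshadow : ∀ᶠ β in atTop, ∀ U : GaugeConfig 3 L SU2, recordWeightRho L δ' ρ δg β U ≠ 0 → orbitDist U < δ β → slowMean L U ∈ 𝒰 β) :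
    ¬ (∀ᶠ β in atTop, Fintype.card (Edge 3 L) * (4 * r β + δ₁ β) < δ' β) := by
  intro h
  obtain ⟨β, hβ0, hβ1, hβρ, hβs, hβ⟩ := (hδ0.and (hδ1.and (hρ.and (hshadow.and h)))).exists
  exact not_support_record_hyp (L := L) hβ0 hβ1 (hδ' β) hβρ (h𝒰δ₁ β) hβs (hr β) hβ

/-- R36c at the record parameters of `innerNoIntruderOneOrbitAt_pow_of_bricks`: `δ = powScale s`, `δ' = 3·powScale s`, `ρ = M·powScale s` (`M ≥ 1`), `s ≥ 0`. [folklore] -/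
theorem not_eventually_support_record_hyp_pow {s t M : ℝ} (hs : 0 ≤ s) (hM : 1 ≤ M) {δ₁ r : ℝ → ℝ} (hr : ∀ β, 0 ≤ r β)
    {𝒰 : ℝ → Set (GaugeConfig 3 1 SU2)} (h𝒰δ₁ : ∀ β, ∀ u ∈ 𝒰 β, orbitDist u < δ₁ β)
    (hshadow : ∀ᶠ β in atTop, ∀ U : GaugeConfig 3 L SU2,
      recordWeightRho L (fun β => 3 * powScale s β) (fun β => M * powScale s β) (powScale t) β U ≠ 0 → orbitDist U < powScale s β → slowMean L U ∈ 𝒰 β) :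
    ¬ (∀ᶠ β in atTop, Fintype.card (Edge 3 L) * (4 * r β + δ₁ β) < 3 * powScale s β) := by
  have hpos : ∀ β, 0 < powScale s β := fun β => by unfold powScale; positivity
  refine not_eventually_support_record_hyp (L := L) (δ := powScale s) (fun _ => rfl) (Eventually.of_forall hpos)
    (Eventually.of_forall fun β => powScale_le_one hs β) (Eventually.of_forall fun β => ?_) hr h𝒰δ₁ hshadow
  have := hpos β; nlinarith

/-! ## §3 The repair: the sharp slow part of the fibre orbit distance -/

/-- Summing a function of the direction over all edges: `Σ_{e ∈ Edge 3 L} f(dir e) = |Site 3 L|·Σ_i f i = (|Edge 3 L|/3)·Σ_i f i`. [folklore] -/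
theorem sum_edge_dir (f : Fin 3 → ℝ) : ∑ e : Edge 3 L, f e.2 = (Fintype.card (Edge 3 L) / 3) * ∑ i : Fin 3, f i := by
  rw [card_edge_eq, Fintype.sum_prod_type]
  show ∑ _x : Site 3 L, ∑ i : Fin 3, f i = _
  rw [Finset.sum_const, Finset.card_univ, nsmul_eq_mul]
  ring

/-- One site: `orbitDist u = Σ_i ‖u_{(0,i)} − 1‖_F`. [folklore] -/
theorem orbitDist_one_site_eq_sum_dir (u : GaugeConfig 3 1 SU2) :
    orbitDist u = ∑ i : Fin 3, frobNorm (((u (0, i) : SU2) : Matrix (Fin 2) (Fin 2) ℂ) - 1) := by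
  rw [orbitDist_one_site_eq, Fintype.sum_prod_type, Fintype.sum_unique]
  rfl

/-- ★ **R36d (sharp fibre orbit distance).**  `orbitDist (orthoTube u v) ≤ (|Edge 3 L|/3)·orbitDist u + 4·Σ_e ‖v_e‖` for `‖v_e‖ ≤ 1/2`: each edge is charged its own
direction's share of the one-site orbit distance, not all of it (compare `orbitDist_orthoTube_le`). [folklore] -/
theorem orbitDist_orthoTube_le_sharp (u : GaugeConfig 3 1 SU2) {v : Edge 3 L → Fin 3 → ℝ} (hv : ∀ e, ‖v e‖ ≤ 1 / 2) :
    orbitDist (orthoTube L u v) ≤ Fintype.card (Edge 3 L) / 3 * orbitDist u + 4 * ∑ e : Edge 3 L, ‖v e‖ := by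
  refine (orbitDist_le 1 _).trans ?_
  unfold gaugeDist
  rw [TT.gaugeTransform_one']
  calc ∑ e : Edge 3 L, frobNorm (((orthoTube L u v e : SU2) : Matrix (Fin 2) (Fin 2) ℂ) - 1)
      ≤ ∑ e : Edge 3 L, (4 * ‖v e‖ + frobNorm (((u (0, e.2) : SU2) : Matrix (Fin 2) (Fin 2) ℂ) - 1)) :=
        Finset.sum_le_sum fun e _ => frobNorm_orthoTube_sub_one_le u e (hv e)
    _ = 4 * ∑ e : Edge 3 L, ‖v e‖ + ∑ e : Edge 3 L, frobNorm (((u (0, e.2) : SU2) : Matrix (Fin 2) (Fin 2) ℂ) - 1) := by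
        rw [Finset.sum_add_distrib, Finset.mul_sum]
    _ = Fintype.card (Edge 3 L) / 3 * orbitDist u + 4 * ∑ e : Edge 3 L, ‖v e‖ := by
        rw [sum_edge_dir (L := L) (fun i => frobNorm (((u (0, i) : SU2) : Matrix (Fin 2) (Fin 2) ℂ) - 1)), ← orbitDist_one_site_eq_sum_dir]
        ring

/-- R36d with radii: `orbitDist₁ u ≤ δ₁`, `‖v_e‖ ≤ r ≤ 1/2` ⇒ `orbitDist (orthoTube u v) ≤ (|Edge 3 L|/3)·δ₁ + 4|Edge 3 L|·r`. [folklore] -/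
theorem orbitDist_orthoTube_le_sharp' {u : GaugeConfig 3 1 SU2} {δ₁ : ℝ} (hu : orbitDist u ≤ δ₁) {v : Edge 3 L → Fin 3 → ℝ} {r : ℝ} (hr : r ≤ 1 / 2)
    (hv : ∀ e, ‖v e‖ ≤ r) : orbitDist (orthoTube L u v) ≤ Fintype.card (Edge 3 L) / 3 * δ₁ + 4 * (Fintype.card (Edge 3 L) * r) := by
  have hN : (0 : ℝ) ≤ Fintype.card (Edge 3 L) := Nat.cast_nonneg _
  have hsum : ∑ e : Edge 3 L, ‖v e‖ ≤ Fintype.card (Edge 3 L) * r :=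
    (Finset.sum_le_sum fun e _ => hv e).trans (by rw [Finset.sum_const, Finset.card_univ, nsmul_eq_mul])
  have h := orbitDist_orthoTube_le_sharp (L := L) u (fun e => (hv e).trans hr)
  nlinarith

/-- **The repaired window is nonempty**: with the sharp bound, `hbo` at fat radius `3δ` needs `(|Edge|/3)·δ₁ + 4|Edge|·r < 3δ`, and `hshadow` needs `|Edge|·δ₁ ≥ 3δ`; both hold for
`δ₁ := 3δ/|Edge 3 L|` as soon as `2|Edge 3 L|·r < δ`. [folklore] -/
theorem sharp_window_nonempty {δ r : ℝ} (hδ : 0 < δ) (hr : 2 * (Fintype.card (Edge 3 L) * r) < δ) :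
    ∃ δ₁ : ℝ, 3 * δ ≤ Fintype.card (Edge 3 L) * δ₁ ∧ Fintype.card (Edge 3 L) / 3 * δ₁ + 4 * (Fintype.card (Edge 3 L) * r) < 3 * δ := by
  have hN3 : (3 : ℝ) ≤ Fintype.card (Edge 3 L) := three_le_card_edge
  have hNpos : (0 : ℝ) < Fintype.card (Edge 3 L) := by linarith
  refine ⟨3 * δ / Fintype.card (Edge 3 L), le_of_eq (mul_div_cancel₀ _ hNpos.ne').symm, ?_⟩
  rw [show (Fintype.card (Edge 3 L) : ℝ) / 3 * (3 * δ / Fintype.card (Edge 3 L)) = δ by field_simp]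
  linarith

end Summit.QuantumFields.YangMills.Theorems.TwistedTraceScaling.Negative.R36

end
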